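import Mathlib
import Literature.LinearAlgebra.Matrix.PermanentLaplace
import Summits.ValiantsHypothesis.ValiantsHypothesis.Theorems.ValuativeGCTValuativeFlipHessenbergCofactors

/-!
# Permanents of bordered block-diagonal matrices with one row replaced by the border row
# (crux `ValuativeGCT.ValuativeFlip`, stmt-ValiantsHypothesis-12624; wall-breaker axis k8 gen 1, seat 2)

Helper file (`--supports stmt-ValiantsHypothesis-12624`), line `four-row-count`.  The block degeneration
`B = B₁ ⊕ εB₂` of the generic pattern (AXIS k8g1 seat 2, §1 D) needs the EXACT values of the border-family
members at a block-diagonal matrix `A ⊕ D` with border row `(v₁, v₂)` and border column `(u₁, u₂)`: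

* `bb_permanent_updateRow_inl/inr` — `per((A ⊕ D); row inl k ← (v₁,v₂)) = per(A; row k ← v₁) · per D`,
  `per((A ⊕ D); row inr k ← (v₁,v₂)) = per A · per(D; row k ← v₂)` (block triangular), and the column versions;
* `bb_permanent_border_updateRow_inl` — for the bordered matrix `BB = [[A ⊕ D, (u₁,u₂)], [(v₁,v₂)ᵀ, 0]]`,
  `per(BB; row (inl inl k) ← last row) = per([[A,u₁],[v₁ᵀ,0]]; row inl k ← last row) · per D
   + 2 · per(A; row k ← v₁) · per [[D,u₂],[v₂ᵀ,0]]`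
  (split both copies of the row `(v₁,v₂,0)` as `(v₁,0,0) + (0,v₂,0)`: three block-triangular pieces and one
  piece that vanishes because the `m` columns of `A` meet only `m - 1` non-zero rows, `bb_permanent_eq_zero_of_card_lt`),
  the `inr` version by the block swap and the column versions by transposition.

All statements are folklore multilinear algebra (Minc, *Permanents* (1978) §1). [folklore]
-/

set_option linter.dupNamespace false

namespace Summit.ValiantsHypothesis.ValiantsHypothesis.Theorems.ValuativeFlip

open scoped BigOperators Matrix
open Equiv Finset Matrix

section BlockBorder

variable {R : Type*} [CommRing R] {m n : Type*} [Fintype m] [Fintype n] [DecidableEq m] [DecidableEq n]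

/-- **Additivity of the permanent in one row.** [folklore] -/
theorem bb_permanent_updateRow_add {ι : Type*} [Fintype ι] [DecidableEq ι] (M : Matrix ι ι R) (i : ι)
    (x y : ι → R) : (M.updateRow i (x + y)).permanent = (M.updateRow i x).permanent + (M.updateRow i y).permanent := by
  rw [← permanent_transpose, ← permanent_transpose (M.updateRow i x), ← permanent_transpose (M.updateRow i y)]
  simp only [← updateCol_transpose]
  simp only [permanent, ← Finset.sum_add_distrib]
  refine Finset.sum_congr rfl fun σ _ => ?_
  rw [← mul_prod_erase _ _ (mem_univ i), ← mul_prod_erase _ _ (mem_univ i), ← mul_prod_erase _ _ (mem_univ i)]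
  have h : ∀ z : ι → R, ∏ j ∈ univ.erase i, (Mᵀ.updateCol i z) (σ j) j = ∏ j ∈ univ.erase i, Mᵀ (σ j) j := by
    intro z
    refine Finset.prod_congr rfl fun j hj => ?_
    rw [updateCol_ne (ne_of_mem_erase hj)]
  simp only [h, updateCol_self, Pi.add_apply, add_mul]

/-- **A permanent vanishes when a set of columns meets too few non-zero rows**: if the entries in the
columns `cols` vanish outside the rows `rows` and `|rows| < |cols|`, then `per M = 0` (every permutation
sends some column of `cols` to a row outside `rows`). [folklore] -/
theorem bb_permanent_eq_zero_of_card_lt {ι : Type*} [Fintype ι] [DecidableEq ι] (M : Matrix ι ι R)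
    (rows cols : Finset ι) (hz : ∀ i, i ∉ rows → ∀ j ∈ cols, M i j = 0) (hcard : rows.card < cols.card) :
    M.permanent = 0 := by
  unfold permanent
  refine Finset.sum_eq_zero fun σ _ => ?_
  -- some column `j ∈ cols` is sent to a row outside `rows`
  have hex : ∃ j ∈ cols, σ j ∉ rows := by
    by_contra h
    push Not at h
    have hsub : cols.image σ ⊆ rows := by
      intro i hi
      obtain ⟨j, hj, rfl⟩ := Finset.mem_image.1 hi
      exact h j hj
    have := Finset.card_le_card hsub
    rw [Finset.card_image_of_injective _ σ.injective] at this
    omega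
  obtain ⟨j, hj, hσj⟩ := hex
  exact Finset.prod_eq_zero (mem_univ j) (hz _ hσj j hj)

/-- Permanent of a block LOWER triangular matrix: `per [[A, 0], [C, D]] = per A · per D` (transpose of
`hb_permanent_fromBlocks_zero₂₁`). [folklore] -/
theorem bb_permanent_fromBlocks_zero₁₂ (A : Matrix m m R) (C : Matrix n m R) (D : Matrix n n R) :
    (Matrix.fromBlocks A 0 C D).permanent = A.permanent * D.permanent := by
  rw [← permanent_transpose, fromBlocks_transpose, transpose_zero, hb_permanent_fromBlocks_zero₂₁,
    permanent_transpose, permanent_transpose]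

/-- **Row `inl k` of a block-diagonal matrix replaced by `(v₁, v₂)`**: the result is block upper triangular,
`per = per(A; row k ← v₁) · per D`. [folklore] -/
theorem bb_permanent_updateRow_inl (A : Matrix m m R) (D : Matrix n n R) (k : m) (v₁ : m → R) (v₂ : n → R) :
    ((Matrix.fromBlocks A 0 0 D).updateRow (Sum.inl k) (Sum.elim v₁ v₂)).permanent =
      (A.updateRow k v₁).permanent * D.permanent := by
  have h : (Matrix.fromBlocks A 0 0 D).updateRow (Sum.inl k) (Sum.elim v₁ v₂) =
      Matrix.fromBlocks (A.updateRow k v₁) (Matrix.of fun i j => if i = k then v₂ j else 0) 0 D := by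
    ext i j
    rcases i with i | i <;> rcases j with j | j
    · by_cases hik : i = k
      · subst hik; simp
      · simp [hik]
    · by_cases hik : i = k
      · subst hik; simp
      · simp [hik]
    · simp
    · simp
  rw [h, hb_permanent_fromBlocks_zero₂₁]

/-- **Row `inr k` of a block-diagonal matrix replaced by `(v₁, v₂)`**: `per = per A · per(D; row k ← v₂)`. [folklore] -/
theorem bb_permanent_updateRow_inr (A : Matrix m m R) (D : Matrix n n R) (k : n) (v₁ : m → R) (v₂ : n → R) :
    ((Matrix.fromBlocks A 0 0 D).updateRow (Sum.inr k) (Sum.elim v₁ v₂)).permanent =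
      A.permanent * (D.updateRow k v₂).permanent := by
  have h : (Matrix.fromBlocks A 0 0 D).updateRow (Sum.inr k) (Sum.elim v₁ v₂) =
      Matrix.fromBlocks A 0 (Matrix.of fun i j => if i = k then v₁ j else 0) (D.updateRow k v₂) := by
    ext i j
    rcases i with i | i <;> rcases j with j | j
    · simp
    · simp
    · by_cases hik : i = k
      · subst hik; simp
      · simp [hik]
    · by_cases hik : i = k
      · subst hik; simp
      · simp [hik]
  rw [h, bb_permanent_fromBlocks_zero₁₂]

/-- Column versions of `bb_permanent_updateRow_inl/inr` (by transposition). [folklore] -/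
theorem bb_permanent_updateCol_inl (A : Matrix m m R) (D : Matrix n n R) (l : m) (u₁ : m → R) (u₂ : n → R) :
    ((Matrix.fromBlocks A 0 0 D).updateCol (Sum.inl l) (Sum.elim u₁ u₂)).permanent =
      (A.updateCol l u₁).permanent * D.permanent := by
  rw [← permanent_transpose, ← updateRow_transpose, fromBlocks_transpose, transpose_zero, transpose_zero,
    bb_permanent_updateRow_inl, ← permanent_transpose, ← updateCol_transpose, transpose_transpose,
    permanent_transpose]

/-- Column version, second block. [folklore] -/
theorem bb_permanent_updateCol_inr (A : Matrix m m R) (D : Matrix n n R) (l : n) (u₁ : m → R) (u₂ : n → R) :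
    ((Matrix.fromBlocks A 0 0 D).updateCol (Sum.inr l) (Sum.elim u₁ u₂)).permanent =
      A.permanent * (D.updateCol l u₂).permanent := by
  rw [← permanent_transpose, ← updateRow_transpose, fromBlocks_transpose, transpose_zero, transpose_zero,
    bb_permanent_updateRow_inr, ← permanent_transpose (Dᵀ.updateRow l u₂), ← updateCol_transpose,
    transpose_transpose, permanent_transpose]

/-- Rows of a matrix can be updated in either order at two different indices. [folklore] -/
theorem bb_updateRow_comm {ι κ α : Type*} [DecidableEq ι] (M : Matrix ι κ α) {a b : ι} (hab : a ≠ b)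
    (x y : κ → α) : (M.updateRow a x).updateRow b y = (M.updateRow b y).updateRow a x := by
  ext i j
  simp only [updateRow_apply]
  by_cases hia : i = a <;> by_cases hib : i = b
  · exact absurd (hia.symm.trans hib) hab
  · simp [hia, hab]
  · simp [hib, Ne.symm hab]
  · simp [hia, hib]

/-- **Bordered block-diagonal matrix, row `inl (inl k)` replaced by the border row.**  For
`BB = [[A ⊕ D, (u₁,u₂)], [(v₁,v₂)ᵀ, 0]]`,
`per(BB; row inl inl k ← last row) = per([[A,u₁],[v₁ᵀ,0]]; row inl k ← its last row) · per D
 + 2 · per(A; row k ← v₁) · per [[D,u₂],[v₂ᵀ,0]]`. [folklore] -/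
theorem bb_permanent_border_updateRow_inl (A : Matrix m m R) (D : Matrix n n R) (u₁ v₁ : m → R) (u₂ v₂ : n → R) (k : m) : ((Matrix.fromBlocks (Matrix.fromBlocks A 0 0 D) (Matrix.of fun (i : m ⊕ n) (_ : Unit) => Sum.elim u₁ u₂ i) (Matrix.of fun (_ : Unit) (j : m ⊕ n) => Sum.elim v₁ v₂ j) (0 : Matrix Unit Unit R)).updateRow (Sum.inl (Sum.inl k)) ((Matrix.fromBlocks (Matrix.fromBlocks A 0 0 D) (Matrix.of fun (i : m ⊕ n) (_ : Unit) => Sum.elim u₁ u₂ i) (Matrix.of fun (_ : Unit) (j : m ⊕ n) => Sum.elim v₁ v₂ j) (0 : Matrix Unit Unit R)) (Sum.inr ()))).permanent = ((Matrix.fromBlocks A (Matrix.of fun (i : m) (_ : Unit) => u₁ i) (Matrix.of fun (_ : Unit) (j : m) => v₁ j) (0 : Matrix Unit Unit R)).updateRow (Sum.inl k) ((Matrix.fromBlocks A (Matrix.of fun (i : m) (_ : Unit) => u₁ i) (Matrix.of fun (_ : Unit) (j : m) => v₁ j) (0 : Matrix Unit Unit R)) (Sum.inr ()))).permanent * D.permanent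 + 2 * (A.updateRow k v₁).permanent * (Matrix.fromBlocks D (Matrix.of fun (i : n) (_ : Unit) => u₂ i) (Matrix.of fun (_ : Unit) (j : n) => v₂ j) (0 : Matrix Unit Unit R)).permanent := by
  -- notation
  set BB : Matrix ((m ⊕ n) ⊕ Unit) ((m ⊕ n) ⊕ Unit) R := Matrix.fromBlocks (Matrix.fromBlocks A 0 0 D)
    (Matrix.of fun (i : m ⊕ n) (_ : Unit) => Sum.elim u₁ u₂ i) (Matrix.of fun (_ : Unit) (j : m ⊕ n) => Sum.elim v₁ v₂ j)
    (0 : Matrix Unit Unit R) with hBB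
  set bA : Matrix (m ⊕ Unit) (m ⊕ Unit) R := Matrix.fromBlocks A (Matrix.of fun (i : m) (_ : Unit) => u₁ i)
    (Matrix.of fun (_ : Unit) (j : m) => v₁ j) (0 : Matrix Unit Unit R) with hbA
  set bD : Matrix (n ⊕ Unit) (n ⊕ Unit) R := Matrix.fromBlocks D (Matrix.of fun (i : n) (_ : Unit) => u₂ i)
    (Matrix.of fun (_ : Unit) (j : n) => v₂ j) (0 : Matrix Unit Unit R) with hbD
  set a : (m ⊕ n) ⊕ Unit := Sum.inl (Sum.inl k) with ha
  set b : (m ⊕ n) ⊕ Unit := Sum.inr () with hb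
  have hab : a ≠ b := by simp [ha, hb]
  -- the two halves of the border row
  set r₁ : (m ⊕ n) ⊕ Unit → R := Sum.elim (Sum.elim v₁ 0) 0 with hr₁
  set r₂ : (m ⊕ n) ⊕ Unit → R := Sum.elim (Sum.elim 0 v₂) 0 with hr₂
  have hlast : BB b = r₁ + r₂ := by
    funext j
    rcases j with (j | j) | j <;> simp [hBB, hb, hr₁, hr₂]
  -- split the replaced row and the border row
  have hM : BB.updateRow a (BB b) = ((BB.updateRow a (r₁ + r₂)).updateRow b (r₁ + r₂)) := by
    conv_lhs => rw [← updateRow_eq_self (BB.updateRow a (BB b)) b]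
    rw [updateRow_ne hab.symm, hlast]
  have hsplit : ∀ x : (m ⊕ n) ⊕ Unit → R,
      ((BB.updateRow a x).updateRow b (r₁ + r₂)).permanent =
        ((BB.updateRow a x).updateRow b r₁).permanent + ((BB.updateRow a x).updateRow b r₂).permanent :=
    fun x => bb_permanent_updateRow_add _ _ _ _
  have hsplit' : ∀ y : (m ⊕ n) ⊕ Unit → R,
      ((BB.updateRow a (r₁ + r₂)).updateRow b y).permanent =
        ((BB.updateRow a r₁).updateRow b y).permanent + ((BB.updateRow a r₂).updateRow b y).permanent := by
    intro y
    rw [bb_updateRow_comm _ hab, bb_permanent_updateRow_add, ← bb_updateRow_comm _ hab, ← bb_updateRow_comm _ hab]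
  -- (1,1): block lower triangular after moving the border index next to block `m`
  have h11 : ((BB.updateRow a r₁).updateRow b r₁).permanent = (bA.updateRow (Sum.inl k) (bA (Sum.inr ()))).permanent * D.permanent := by
    let e : (m ⊕ Unit) ⊕ n ≃ (m ⊕ n) ⊕ Unit :=
      (Equiv.sumAssoc m Unit n).trans (((Equiv.refl m).sumCongr (Equiv.sumComm Unit n)).trans (Equiv.sumAssoc m n Unit).symm)
    have he1 : ∀ i : m, e (Sum.inl (Sum.inl i)) = Sum.inl (Sum.inl i) := fun i => rfl
    have he2 : e (Sum.inl (Sum.inr ())) = Sum.inr () := rfl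
    have he3 : ∀ j : n, e (Sum.inr j) = Sum.inl (Sum.inr j) := fun j => rfl
    have hmat : ((BB.updateRow a r₁).updateRow b r₁).submatrix e e =
        Matrix.fromBlocks (bA.updateRow (Sum.inl k) (bA (Sum.inr ()))) 0
          (Matrix.of fun (i : n) (j : m ⊕ Unit) => Sum.elim (fun _ => (0 : R)) (fun _ => u₂ i) j) D := by
      ext i j
      rcases i with (i | i) | i <;> rcases j with (j | j) | j
      all_goals simp only [submatrix_apply, he1, he2, he3]
      all_goals
        simp only [hBB, hbA, ha, hb, hr₁, updateRow_apply, fromBlocks_apply₁₁, fromBlocks_apply₁₂,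
          fromBlocks_apply₂₁, fromBlocks_apply₂₂, Matrix.of_apply, Sum.elim_inl, Sum.elim_inr, Sum.inl.injEq,
          reduceCtorEq, Pi.zero_apply, Matrix.zero_apply, if_true, if_false]
      all_goals (split_ifs <;> rfl)
    rw [← permanent_submatrix_equiv e, hmat, bb_permanent_fromBlocks_zero₁₂]
  -- (1,2): block upper triangular for the grouping `m | n ⊕ Unit`
  have h12 : ((BB.updateRow a r₁).updateRow b r₂).permanent = (A.updateRow k v₁).permanent * bD.permanent := by
    let e : m ⊕ (n ⊕ Unit) ≃ (m ⊕ n) ⊕ Unit := (Equiv.sumAssoc m n Unit).symm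
    have he1 : ∀ i : m, e (Sum.inl i) = Sum.inl (Sum.inl i) := fun i => rfl
    have he2 : ∀ j : n, e (Sum.inr (Sum.inl j)) = Sum.inl (Sum.inr j) := fun j => rfl
    have he3 : e (Sum.inr (Sum.inr ())) = Sum.inr () := rfl
    have hmat : ((BB.updateRow a r₁).updateRow b r₂).submatrix e e =
        Matrix.fromBlocks (A.updateRow k v₁)
          (Matrix.of fun (i : m) (j : n ⊕ Unit) => if i = k then 0 else Sum.elim (fun _ => (0 : R)) (fun _ => u₁ i) j)
          0 bD := by
      ext i j
      rcases i with i | (i | i) <;> rcases j with j | (j | j)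
      all_goals simp only [submatrix_apply, he1, he2, he3]
      all_goals
        simp only [hBB, hbD, ha, hb, hr₁, hr₂, updateRow_apply, fromBlocks_apply₁₁, fromBlocks_apply₁₂,
          fromBlocks_apply₂₁, fromBlocks_apply₂₂, Matrix.of_apply, Sum.elim_inl, Sum.elim_inr, Sum.inl.injEq,
          reduceCtorEq, Pi.zero_apply, Matrix.zero_apply, if_true, if_false]
    rw [← permanent_submatrix_equiv e, hmat, hb_permanent_fromBlocks_zero₂₁]
  -- (2,1) = (1,2) by swapping the two rows
  have h21 : ((BB.updateRow a r₂).updateRow b r₁).permanent = ((BB.updateRow a r₁).updateRow b r₂).permanent := by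
    have hmat : (BB.updateRow a r₂).updateRow b r₁ = ((BB.updateRow a r₁).updateRow b r₂).submatrix (Equiv.swap a b) id := by
      ext i j
      simp only [submatrix_apply, id, updateRow_apply]
      by_cases hia : i = a
      · subst hia
        simp [Equiv.swap_apply_left, hab]
      · by_cases hib : i = b
        · subst hib
          simp [Equiv.swap_apply_right]
        · rw [Equiv.swap_apply_of_ne_of_ne hia hib]
          simp [hia, hib]
    rw [hmat, permanent_permute_cols]
  -- (2,2) vanishes: the `m` columns of `A` meet only the `m - 1` rows `inl inl i`, `i ≠ k`
  have h22 : ((BB.updateRow a r₂).updateRow b r₂).permanent = 0 := by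
    refine bb_permanent_eq_zero_of_card_lt _ ((Finset.univ.erase k).image fun i : m => (Sum.inl (Sum.inl i) : (m ⊕ n) ⊕ Unit))
      (Finset.univ.image fun j : m => (Sum.inl (Sum.inl j) : (m ⊕ n) ⊕ Unit)) ?_ ?_
    · intro i hi j hj
      obtain ⟨j, -, rfl⟩ := Finset.mem_image.1 hj
      have hi' : ∀ i' : m, i' ≠ k → i ≠ Sum.inl (Sum.inl i') := by
        intro i' hi'k h
        exact hi (Finset.mem_image.2 ⟨i', Finset.mem_erase.2 ⟨hi'k, Finset.mem_univ _⟩, h.symm⟩)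
      rcases i with (i | i) | i
      · have hik : i = k := by
          by_contra h
          exact hi' i h rfl
        subst hik
        simp [ha, hb, hr₂, updateRow_apply]
      · simp [hBB, ha, hb, hr₂, updateRow_apply]
      · simp [ha, hb, hr₂, updateRow_apply]
    · have hinj : Function.Injective fun i : m => (Sum.inl (Sum.inl i) : (m ⊕ n) ⊕ Unit) :=
        fun x y h => by simpa using h
      rw [Finset.card_image_of_injective _ hinj, Finset.card_image_of_injective _ hinj, Finset.card_erase_of_mem
        (Finset.mem_univ k), Finset.card_univ]
      exact Nat.sub_lt (Fintype.card_pos_iff.2 ⟨k⟩) (by norm_num)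
  rw [hM, hsplit, hsplit', hsplit', h11, h12, h21, h12, h22]
  ring

/-- **Bordered block-diagonal matrix, row `inl (inr k)` replaced by the border row** (from the `inl` version
by swapping the two blocks):
`per(BB; row inl inr k ← last row) = per A · per([[D,u₂],[v₂ᵀ,0]]; row inl k ← its last row)
 + 2 · per [[A,u₁],[v₁ᵀ,0]] · per(D; row k ← v₂)`. [folklore] -/
theorem bb_permanent_border_updateRow_inr (A : Matrix m m R) (D : Matrix n n R) (u₁ v₁ : m → R)
    (u₂ v₂ : n → R) (k : n) :
    ((Matrix.fromBlocks (Matrix.fromBlocks A 0 0 D) (Matrix.of fun (i : m ⊕ n) (_ : Unit) => Sum.elim u₁ u₂ i)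
        (Matrix.of fun (_ : Unit) (j : m ⊕ n) => Sum.elim v₁ v₂ j) (0 : Matrix Unit Unit R)).updateRow
        (Sum.inl (Sum.inr k))
        ((Matrix.fromBlocks (Matrix.fromBlocks A 0 0 D) (Matrix.of fun (i : m ⊕ n) (_ : Unit) => Sum.elim u₁ u₂ i)
          (Matrix.of fun (_ : Unit) (j : m ⊕ n) => Sum.elim v₁ v₂ j) (0 : Matrix Unit Unit R)) (Sum.inr ()))).permanent =
      A.permanent * ((Matrix.fromBlocks D (Matrix.of fun (i : n) (_ : Unit) => u₂ i) (Matrix.of fun (_ : Unit) (j : n) => v₂ j)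
          (0 : Matrix Unit Unit R)).updateRow (Sum.inl k)
          ((Matrix.fromBlocks D (Matrix.of fun (i : n) (_ : Unit) => u₂ i) (Matrix.of fun (_ : Unit) (j : n) => v₂ j)
            (0 : Matrix Unit Unit R)) (Sum.inr ()))).permanent +
      2 * (Matrix.fromBlocks A (Matrix.of fun (i : m) (_ : Unit) => u₁ i) (Matrix.of fun (_ : Unit) (j : m) => v₁ j)
          (0 : Matrix Unit Unit R)).permanent * (D.updateRow k v₂).permanent := by
  set BB : Matrix ((m ⊕ n) ⊕ Unit) ((m ⊕ n) ⊕ Unit) R := Matrix.fromBlocks (Matrix.fromBlocks A 0 0 D)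
    (Matrix.of fun (i : m ⊕ n) (_ : Unit) => Sum.elim u₁ u₂ i) (Matrix.of fun (_ : Unit) (j : m ⊕ n) => Sum.elim v₁ v₂ j)
    (0 : Matrix Unit Unit R) with hBB
  set BB' : Matrix ((n ⊕ m) ⊕ Unit) ((n ⊕ m) ⊕ Unit) R := Matrix.fromBlocks (Matrix.fromBlocks D 0 0 A)
    (Matrix.of fun (i : n ⊕ m) (_ : Unit) => Sum.elim u₂ u₁ i) (Matrix.of fun (_ : Unit) (j : n ⊕ m) => Sum.elim v₂ v₁ j)
    (0 : Matrix Unit Unit R) with hBB'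
  let s : (n ⊕ m) ⊕ Unit ≃ (m ⊕ n) ⊕ Unit := (Equiv.sumComm n m).sumCongr (Equiv.refl Unit)
  have hs1 : ∀ i : n, s (Sum.inl (Sum.inl i)) = Sum.inl (Sum.inr i) := fun i => rfl
  have hs2 : ∀ i : m, s (Sum.inl (Sum.inr i)) = Sum.inl (Sum.inl i) := fun i => rfl
  have hs3 : s (Sum.inr ()) = Sum.inr () := rfl
  have hsub : BB.submatrix s s = BB' := by
    ext i j
    rcases i with (i | i) | i <;> rcases j with (j | j) | j <;>
      simp [hBB, hBB', hs1, hs2, hs3, submatrix_apply]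
  have hrow : (fun j => BB (Sum.inr ()) (s j)) = BB' (Sum.inr ()) := by
    funext j
    have := congrFun (congrFun hsub (Sum.inr ())) j
    simpa [submatrix_apply, hs3] using this
  have key : (BB.updateRow (Sum.inl (Sum.inr k)) (BB (Sum.inr ()))).submatrix s s =
      BB'.updateRow (Sum.inl (Sum.inl k)) (BB' (Sum.inr ())) := by
    rw [submatrix_updateRow_equiv, hsub, hrow]
    congr 1
  rw [← permanent_submatrix_equiv s, key, hBB', bb_permanent_border_updateRow_inl D A u₂ v₂ u₁ v₁ k]
  ring

omit [Fintype m] [Fintype n] [DecidableEq m] [DecidableEq n] in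
/-- Transpose of the bordered block-diagonal matrix: swap `u ↔ v` and transpose the blocks. [folklore] -/
theorem bb_border_transpose (A : Matrix m m R) (D : Matrix n n R) (u₁ v₁ : m → R) (u₂ v₂ : n → R) :
    (Matrix.fromBlocks (Matrix.fromBlocks A 0 0 D) (Matrix.of fun (i : m ⊕ n) (_ : Unit) => Sum.elim u₁ u₂ i)
        (Matrix.of fun (_ : Unit) (j : m ⊕ n) => Sum.elim v₁ v₂ j) (0 : Matrix Unit Unit R))ᵀ =
      Matrix.fromBlocks (Matrix.fromBlocks Aᵀ 0 0 Dᵀ) (Matrix.of fun (i : m ⊕ n) (_ : Unit) => Sum.elim v₁ v₂ i)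
        (Matrix.of fun (_ : Unit) (j : m ⊕ n) => Sum.elim u₁ u₂ j) (0 : Matrix Unit Unit R) := by
  rw [fromBlocks_transpose, fromBlocks_transpose]
  congr 1

/-- Transpose of a singly bordered matrix. [folklore] -/
theorem bb_border_transpose₁ {p : Type*} (P : Matrix p p R) (x y : p → R) :
    (Matrix.fromBlocks P (Matrix.of fun (i : p) (_ : Unit) => x i) (Matrix.of fun (_ : Unit) (j : p) => y j)
        (0 : Matrix Unit Unit R))ᵀ =
      Matrix.fromBlocks Pᵀ (Matrix.of fun (i : p) (_ : Unit) => y i) (Matrix.of fun (_ : Unit) (j : p) => x j)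
        (0 : Matrix Unit Unit R) := by
  rw [fromBlocks_transpose]
  congr 1

/-- **Bordered block-diagonal matrix, column `inl (inl l)` replaced by the border column** (transpose of
`bb_permanent_border_updateRow_inl`). [folklore] -/
theorem bb_permanent_border_updateCol_inl (A : Matrix m m R) (D : Matrix n n R) (u₁ v₁ : m → R)
    (u₂ v₂ : n → R) (l : m) :
    ((Matrix.fromBlocks (Matrix.fromBlocks A 0 0 D) (Matrix.of fun (i : m ⊕ n) (_ : Unit) => Sum.elim u₁ u₂ i)
        (Matrix.of fun (_ : Unit) (j : m ⊕ n) => Sum.elim v₁ v₂ j) (0 : Matrix Unit Unit R)).updateCol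
        (Sum.inl (Sum.inl l))
        (fun i => (Matrix.fromBlocks (Matrix.fromBlocks A 0 0 D) (Matrix.of fun (i : m ⊕ n) (_ : Unit) => Sum.elim u₁ u₂ i)
          (Matrix.of fun (_ : Unit) (j : m ⊕ n) => Sum.elim v₁ v₂ j) (0 : Matrix Unit Unit R)) i (Sum.inr ()))).permanent =
      ((Matrix.fromBlocks A (Matrix.of fun (i : m) (_ : Unit) => u₁ i) (Matrix.of fun (_ : Unit) (j : m) => v₁ j)
          (0 : Matrix Unit Unit R)).updateCol (Sum.inl l)
          (fun i => (Matrix.fromBlocks A (Matrix.of fun (i : m) (_ : Unit) => u₁ i) (Matrix.of fun (_ : Unit) (j : m) => v₁ j)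
            (0 : Matrix Unit Unit R)) i (Sum.inr ()))).permanent * D.permanent +
      2 * (A.updateCol l u₁).permanent *
        (Matrix.fromBlocks D (Matrix.of fun (i : n) (_ : Unit) => u₂ i) (Matrix.of fun (_ : Unit) (j : n) => v₂ j)
          (0 : Matrix Unit Unit R)).permanent := by
  have h := bb_permanent_border_updateRow_inl Aᵀ Dᵀ v₁ u₁ v₂ u₂ l
  rw [← bb_border_transpose, ← bb_border_transpose₁, ← bb_border_transpose₁, permanent_transpose,
    permanent_transpose] at h
  rw [← permanent_transpose, ← updateRow_transpose, ← permanent_transpose (Matrix.updateCol _ (Sum.inl l) _),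
    ← updateRow_transpose, ← permanent_transpose (A.updateCol l u₁), ← updateRow_transpose]
  convert h using 3 <;> rfl

/-- **Bordered block-diagonal matrix, column `inl (inr l)` replaced by the border column** (transpose of
`bb_permanent_border_updateRow_inr`). [folklore] -/
theorem bb_permanent_border_updateCol_inr (A : Matrix m m R) (D : Matrix n n R) (u₁ v₁ : m → R)
    (u₂ v₂ : n → R) (l : n) :
    ((Matrix.fromBlocks (Matrix.fromBlocks A 0 0 D) (Matrix.of fun (i : m ⊕ n) (_ : Unit) => Sum.elim u₁ u₂ i)
        (Matrix.of fun (_ : Unit) (j : m ⊕ n) => Sum.elim v₁ v₂ j) (0 : Matrix Unit Unit R)).updateCol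
        (Sum.inl (Sum.inr l))
        (fun i => (Matrix.fromBlocks (Matrix.fromBlocks A 0 0 D) (Matrix.of fun (i : m ⊕ n) (_ : Unit) => Sum.elim u₁ u₂ i)
          (Matrix.of fun (_ : Unit) (j : m ⊕ n) => Sum.elim v₁ v₂ j) (0 : Matrix Unit Unit R)) i (Sum.inr ()))).permanent =
      A.permanent * ((Matrix.fromBlocks D (Matrix.of fun (i : n) (_ : Unit) => u₂ i) (Matrix.of fun (_ : Unit) (j : n) => v₂ j)
          (0 : Matrix Unit Unit R)).updateCol (Sum.inl l)
          (fun i => (Matrix.fromBlocks D (Matrix.of fun (i : n) (_ : Unit) => u₂ i) (Matrix.of fun (_ : Unit) (j : n) => v₂ j)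
            (0 : Matrix Unit Unit R)) i (Sum.inr ()))).permanent +
      2 * (Matrix.fromBlocks A (Matrix.of fun (i : m) (_ : Unit) => u₁ i) (Matrix.of fun (_ : Unit) (j : m) => v₁ j)
          (0 : Matrix Unit Unit R)).permanent * (D.updateCol l u₂).permanent := by
  have h := bb_permanent_border_updateRow_inr Aᵀ Dᵀ v₁ u₁ v₂ u₂ l
  rw [← bb_border_transpose, ← bb_border_transpose₁, ← bb_border_transpose₁, permanent_transpose,
    permanent_transpose] at h
  rw [← permanent_transpose, ← updateRow_transpose, ← permanent_transpose (Matrix.updateCol _ (Sum.inl l) _),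
    ← updateRow_transpose, ← permanent_transpose (D.updateCol l u₂), ← updateRow_transpose]
  convert h using 3 <;> rfl

end BlockBorder

end Summit.ValiantsHypothesis.ValiantsHypothesis.Theorems.ValuativeFlip
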